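import Literature.NumberTheory.Automorphic.GL2RSLFactorUnramified
import Literature.NumberTheory.Automorphic.GL2RSLFactorUnramifiedComputation
import Literature.NumberTheory.Automorphic.GL2UnramifiedLFactorDivisibility
import Literature.NumberTheory.Automorphic.ShintaniWhittakerFormula
import HarnessLib

/-!
# The unramified `L`-factor divides every JPSS `L`-polynomial of `(π, 1)` on `GL_n`:
# `∏_{a ∈ α} (1 - a T) ∣ P` for a Satake parameter `α` of `π` (`n ≥ 2`)

Topic `Literature/NumberTheory/Automorphic`; proof file (theorems only: no definition, no named fact,
no instance).  Let `F` be a non-archimedean local field (`q = #k_F`, `ϖ` uniformising), `2 ≤ n`, `π` an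
IRREDUCIBLE smooth representation of `GL_n(F)` on `V`, generic for the continuous non-trivial additive
character `ψ` (any conductor), and `α` a Satake parameter of `π` (`IsSatakeParameter π ϖ α` of
`SatakeParametersGL`).  The main results, the rank-`n` forms of `GL2UnramifiedLFactorDivisibility`
(`n = 2`, which argues through the torus recursion instead of Shintani's closed formula):

* `prod_one_sub_C_mul_X_dvd_of_hasRSLFactor_gl`: for every `GL₁(F)`-invariant Radon full-support
  measure `ν` on `GL₁(F) ⧸ U₁`, every polynomial `P` with `HasRSLFactor hn π 𝟙_{GL₁} ψ ν P` — a JPSS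
  `L`-polynomial of the pair `(π, 1)`, `L(s, π × 1) = 1 / P(q^{-s})` (`RankinSelbergLocal`) — is divisible
  by `P_α = ∏_{a ∈ α} (1 - a X)`; and `prod_one_sub_C_mul_X_eq_of_hasRSLFactor_of_natDegree_le_gl`:
  it EQUALS `P_α` as soon as `deg P ≤ n`.  In words: the standard `L`-factor of a representation carrying
  the Hecke eigenvalues of `α` has at least the poles of `∏ (1 - a q^{-s})⁻¹` — the unramified
  computation of Jacquet–Shalika 1981 §2 / Cogdell 2004 Thm. 3.3 read for the single spherical test
  vector; no classification of spherical representations and no Jacquet-module finiteness is used.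
* `rsZeta_spherical_trivial_eq_gl` — **the unramified computation itself** (`GL_n × GL₁`, trivial
  character): for `ψ` of conductor `𝒪`, a `GL_n(𝒪)`-fixed Hecke eigenvector `v` with the eigenvalues of
  `α`, a `ψ`-Whittaker functional `Λ` and the constant Whittaker function `W' = Λ'(v')` of the trivial
  representation of `GL₁(F)` on `ℂ`, EXACTLY
  `Ψ(s; W_v, W') = μ'(𝒪ˣ) Λ(v) Λ'(v') / ∏ (1 - a q^{-s})` whenever `|a q^{-s}| < 1` (`a ∈ α`), `μ'`
  being the Haar measure of `Fˣ` transported to `ν`.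
* the corner bookkeeping on `d(a) = glCorner F _ (glDiagonal 1 F a) = diag(a, 1_{n-1})`:
  `glCorner_glDiagonal_fin_one_eq_diagonalGL'`, `glCorner_glDiagonal_fin_one_mem_glInt'`,
  `glCorner_glDiagonal_fin_one_mul_diagonalGL_comm'`, `whittakerModel_transvectionGL_glCorner'`,
  `whittakerModel_glCorner_eq_zero_of_one_lt` (vanishing beyond the conductor),
  `whittakerModel_glCorner_mul_of_valuation_eq_one` (`𝒪ˣ`-invariance),
  `whittakerModel_apply_diagonalGL_glCorner_eq_comp`, `dual_comp_rep_ne_zero'`,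
  `rsIntegrand_glDiagonal_fin_one_gl`, `rsZeta_fin_one_eq_integral_corner` (the `(n,1)` zeta integral
  against a constant `W'` is the corner-torus integral), `inv_residueFieldCard_cpow_sub_pred_half'`.

These theorems were first landed summit-side (line `Sketch` of the Langlands crux
`ReciprocityUpToIrreducibility`, continuation c6: `Summits/Langlands/Langlands/Theorems/
IrreducibilityBySelfDualityReciprocityUpToIrreducibility{CornerZetaIntegral,SphericalWhittakerCorner,
CornerDiagonalComm,SphericalZetaGLn,UnramifiedMatchingGLn}.lean`); they are re-homed here verbatim (primed
names where the summit-side name would be ambiguous under `open`) so that Literature files — which may not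
import `Summits` — can use the `GL_n` unramified divisibility (e.g. Carayol-type local–global deductions
in rank `n`, as `CarayolCompatibilityOfLocalGlobalProofs` does with the `n = 2` file).

## Proof

1.  (`rsZeta_fin_one_eq_integral_corner`) For `m = 1` the quotient `GL₁(F) ⧸ U₁` is `Fˣ` and
    `Ψ(s; W, W')` against a constant `W' = κ` is `∫_{Fˣ} W(d(a)) κ |a|^{s-(n-1)/2} dμ'(a)`
    (`rsKernel_mk_of_fin_one`, `a ↦ a⁻¹` by `integral_inv_eq_self`).
2.  For `v` spherical, `ψ` of conductor `𝒪`: `W_v(d(a)) = 0` for `|a| > 1` (the transvection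
    `1 + x E₁₂ ∈ GL_n(𝒪)`, `x ∈ 𝒪` with `ψ(a x) ≠ 1`, gives `W_v(d(a)) = ψ(a x) W_v(d(a))`), and
    `W_v(d(t u)) = W_v(d(t))` for `|u| = 1`; so the shell decomposition `integral_units_eq_tsum_shell`
    (`TateLocalZetaShells`) turns the integral into `μ'(𝒪ˣ) ∑_N W_v(d(ϖ^N)) κ (q^{(n-1)/2} q^{-s})^N`,
    which is the corner torus sum of `RankinSelbergUnramifiedTorus` at `m = 1`
    (`hasSum_whittakerModel_cornerTorus`: Shintani's formula and Cauchy's identity),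
    `= Λ(v) Λ'(v') / P_{α,{1}}(q^{-s})`, `P_{α,{1}} = ∏ (1 - a X)` (`satakePairPolynomial_singleton_one`).
3.  For a general `ψ` pick `a` with `aψ` of conductor `𝒪`; `Λ_a = Λ ∘ π(diag(1, a⁻¹, …, a^{1-n}))` is an
    `aψ`-Whittaker functional (`comp_diagonalGL_mem_whittakerFunctionals`), non-zero on a spherical Hecke
    eigenvector `v` (`exists_spherical_whittaker_ne_zero_of_isSatakeParameter`, Casselman–Shalika), and the
    `(n,1)` zeta integral of `W_{Λ, π(d) v} ∈ 𝒲(π, ψ)` equals that of `W_{Λ_a, v}` (both only sample the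
    corner torus, on which they agree since diagonal matrices commute).
4.  Clause (a) of `HasRSLFactor … P` gives `Ψ = R(q^{-s}) / P(q^{-s})` with `R` Laurent; comparing with
    `c / P_α(q^{-s})`, `c ≠ 0`, at `s = j ∈ ℕ` large: `P_α ∣ P` (`dvd_of_eval_mul_eq_const`).  If
    `deg P ≤ n = deg P_α` (all `a ≠ 0`) then `P = P_α` by comparing constant terms.

## References

* H. Jacquet, J. A. Shalika, *On Euler products and the classification of automorphic representations
  I*, Amer. J. Math. 103 (1981), §2. [JacquetShalika1981]
* H. Jacquet, I. I. Piatetski-Shapiro, J. Shalika, *Rankin–Selberg convolutions*, Amer. J. Math. 105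
  (1983), §2.4, Thm. 2.7 (ii). [JacquetPiatetskiShapiroShalika1983]
* J. W. Cogdell, *Analytic theory of L-functions for GL_n* (2004), §6.1, Thm. 3.3. [CogdellAnalyticTheory2004]
* T. Shintani, Proc. Japan Acad. 52 (1976), 180–182. [Shintani1976]
* W. Casselman, J. Shalika, Compositio Math. 41 (1980), Thm. 5.4. [CasselmanShalika1980]
* H. Jacquet, R. P. Langlands, *Automorphic forms on GL(2)*, LNM 114 (1970), Prop. 3.5. [JacquetLanglands1970]
-/

noncomputable section

open scoped MatrixGroups NNReal
open MeasureTheory ValuativeRel Polynomial Filter Finset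
  Literature.NumberTheory.GaloisRepresentations.IsNonarchimedeanLocalField
  Literature.NumberTheory.EllipticCurves.Hida2000Thm326

namespace Literature.NumberTheory.Automorphic

/-! ### Part 1: the corner torus `d(a) = diag(a, 1_{n-1})` -/

section Corner

variable {F : Type*} [Field F] {n : ℕ}

/-- **The `GL₁`-corner of `GL_n` is a diagonal torus element**:
`glCorner F h (glDiagonal 1 F a) = diag(a, 1, …, 1) = diagonalGL (i ↦ if i = 0 then a else 1)`.
[folklore] -/
theorem glCorner_glDiagonal_fin_one_eq_diagonalGL' (h : 1 ≤ n) (a : Fˣ) :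
    glCorner F h (glDiagonal 1 F fun _ => a) =
      diagonalGL (Fin n) F fun i => if (i : ℕ) = 0 then a else 1 := by
  refine Matrix.GeneralLinearGroup.ext fun i j => ?_
  obtain ⟨x, rfl⟩ := (finBlockEquiv h).surjective i
  obtain ⟨y, rfl⟩ := (finBlockEquiv h).surjective j
  rw [coe_diagonalGL]
  rcases x with a' | b <;> rcases y with a'' | b'
  · obtain rfl : a' = a'' := Subsingleton.elim _ _
    rw [glCorner_apply_inl_inl, coe_glDiagonal, Matrix.diagonal_apply_eq, Matrix.diagonal_apply_eq,
      coe_finBlockEquiv_inl, if_pos (Fin.fin_one_eq_zero a' ▸ rfl)]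
  · rw [glCorner_apply_inl_inr, Matrix.diagonal_apply_ne]
    exact fun hxy => Sum.inl_ne_inr ((finBlockEquiv h).injective hxy)
  · rw [glCorner_apply_inr_inl, Matrix.diagonal_apply_ne]
    exact fun hxy => Sum.inr_ne_inl ((finBlockEquiv h).injective hxy)
  · by_cases hbb : b = b'
    · subst hbb
      rw [glCorner_apply_inr_inr, Matrix.one_apply_eq, Matrix.diagonal_apply_eq,
        coe_finBlockEquiv_inr, if_neg (by omega), Units.val_one]
    · rw [glCorner_apply_inr_inr, Matrix.one_apply_ne hbb, Matrix.diagonal_apply_ne]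
      exact fun hxy => hbb (Sum.inr_injective ((finBlockEquiv h).injective hxy))

/-- **`diag(u, 1_{n-1}) ∈ GL_n(𝒪)` for a unit `u` of valuation `1`** (rank-`n` form of
`glDiagonal_fin_one_mem_glInt`, `diagGL2_mem_glInt`). [folklore] -/
theorem glCorner_glDiagonal_fin_one_mem_glInt' [ValuativeRel F] (h : 1 ≤ n) {u : Fˣ}
    (hu : valuation F (u : F) = 1) : glCorner F h (glDiagonal 1 F fun _ => u) ∈ glInt n F := by
  rw [glCorner_glDiagonal_fin_one_eq_diagonalGL']
  refine diagonalGL_mem_glInt fun i => ?_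
  split_ifs
  · exact hu
  · rw [Units.val_one, map_one]

/-- **The corner torus commutes with the diagonal torus**:
`diag(h, 1, …, 1) · diag(d) = diag(d) · diag(h, 1, …, 1)` in `GL_n(F)`. [folklore] -/
theorem glCorner_glDiagonal_fin_one_mul_diagonalGL_comm' (hn : 1 ≤ n) (h : Fˣ) (d : Fin n → Fˣ) :
    glCorner F hn (glDiagonal 1 F fun _ => h) * diagonalGL (Fin n) F d =
      diagonalGL (Fin n) F d * glCorner F hn (glDiagonal 1 F fun _ => h) := by
  rw [glCorner_glDiagonal_fin_one_eq_diagonalGL', ← map_mul, ← map_mul, mul_comm]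

variable {V : Type*} [AddCommGroup V] [Module ℂ V] (π : Representation ℂ (GL (Fin n) F) V)

/-- **Right translation of the corner Whittaker value by an elementary unipotent**: for a
`ψ`-Whittaker functional `Λ`, `W_{π(1 + x E₁₂) v}(d(a)) = ψ(a x) W_v(d(a))` on
`d(a) = diag(a, 1_{n-1})`, since `d(a) (1 + x E₁₂) = (1 + a x E₁₂) d(a)` and
`ψ_U(1 + a x E₁₂) = ψ(a x)` (rank-`n` form of `whittakerModel_unipotentGL2_diagGL2`). [folklore] -/
theorem whittakerModel_transvectionGL_glCorner' (hn : 1 < n) {ψ : AddChar F Circle}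
    {Λ : Module.Dual ℂ V} (hΛ : Λ ∈ whittakerFunctionals π ψ) (v : V) (a : Fˣ) (x : F)
    (h01 : (⟨0, Nat.zero_lt_of_lt hn⟩ : Fin n) ≠ ⟨1, hn⟩) :
    whittakerModel π Λ (π (transvectionGL (⟨0, Nat.zero_lt_of_lt hn⟩ : Fin n) ⟨1, hn⟩ h01 x) v)
        (glCorner F hn.le (glDiagonal 1 F fun _ => a)) =
      ψ ((a : F) * x) * whittakerModel π Λ v (glCorner F hn.le (glDiagonal 1 F fun _ => a)) := by
  rw [← whittakerModel_apply_apply_mul, glCorner_glDiagonal_fin_one_eq_diagonalGL']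
  set d : Fin n → Fˣ := fun i => if (i : ℕ) = 0 then a else 1 with hd
  have hlt : (⟨0, Nat.zero_lt_of_lt hn⟩ : Fin n) < ⟨1, hn⟩ := Fin.mk_lt_mk.2 Nat.zero_lt_one
  have hU : diagonalGL (Fin n) F d * transvectionGL _ _ h01 x * (diagonalGL (Fin n) F d)⁻¹ ∈
      upperUnitriangular (Fin n) F :=
    diagonalGL_conj_mem_upperUnitriangular d (transvectionGL_mem_upperUnitriangular hlt x)
  have hfac : diagonalGL (Fin n) F d * transvectionGL _ _ h01 x =
      ((⟨_, hU⟩ : ↥(upperUnitriangular (Fin n) F)) : GL (Fin n) F) * diagonalGL (Fin n) F d := by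
    rw [inv_mul_cancel_right]
  rw [hfac, whittakerModel_apply, whittakerModel_apply, map_mul, Module.End.mul_apply,
    (mem_whittakerFunctionals_iff Λ).1 hΛ, whittakerCharFun_apply,
    superdiagSum_conj_transvectionGL d
      (show (((⟨0, Nat.zero_lt_of_lt hn⟩ : Fin n) : ℕ) + 1 = ((⟨1, hn⟩ : Fin n) : ℕ)) from rfl) x]
  have hd0 : d ⟨0, Nat.zero_lt_of_lt hn⟩ = a := if_pos rfl
  have hd1 : d ⟨1, hn⟩ = 1 := if_neg Nat.one_ne_zero
  rw [hd0, hd1, inv_one, Units.val_one, mul_one]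

/-- **Vanishing beyond the conductor on the corner**: for `v` fixed by `GL_n(𝒪)`, `ψ` of conductor `𝒪`
and `Λ` a `ψ`-Whittaker functional, `W_v(d(a)) = 0` for `|a| > 1` — for `x ∈ 𝒪` the unipotent
`1 + x E₁₂ ∈ GL_n(𝒪)` fixes `v`, so `W_v(d(a)) = ψ(a x) W_v(d(a))`, and `ψ(a 𝒪) ≠ 1`.  Rank-`n` form
of `whittakerModel_diagGL2_eq_zero_of_one_lt` (Jacquet–Langlands 1970, proof of Prop. 3.5 for
`n = 2`). [cite: JacquetPiatetskiShapiroShalika1983, §2.4] -/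
theorem whittakerModel_glCorner_eq_zero_of_one_lt [ValuativeRel F] [TopologicalSpace F]
    [IsNonarchimedeanLocalField F] (hn : 1 < n) {ψ : AddChar F Circle} (hψ : ψ.HasConductorExp 0)
    {Λ : Module.Dual ℂ V} (hΛ : Λ ∈ whittakerFunctionals π ψ) {v : V}
    (hv : v ∈ π.fixedPoints (glInt n F)) {a : Fˣ} (ha : 1 < normAbs F (a : F)) :
    whittakerModel π Λ v (glCorner F hn.le (glDiagonal 1 F fun _ => a)) = 0 := by
  have ha' : (a : F) ∉ primePowBall F (0 - 0) := by
    rw [sub_zero, mem_primePowBall_iff, zpow_zero]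
    exact not_le.2 ha
  obtain ⟨x₀, hx₀, hne⟩ := exists_mem_primePowBall_addChar_mul_ne_one hψ ha'
  have hx₀O : x₀ ∈ (valuation F).integer := by
    rw [mem_primePowBall_iff, zpow_zero, normAbs_le_one_iff] at hx₀
    exact hx₀
  have h01 : (⟨0, Nat.zero_lt_of_lt hn⟩ : Fin n) ≠ ⟨1, hn⟩ :=
    Fin.ne_of_lt (Fin.mk_lt_mk.2 Nat.zero_lt_one)
  have hfix : π (transvectionGL (⟨0, Nat.zero_lt_of_lt hn⟩ : Fin n) ⟨1, hn⟩ h01 x₀) v = v :=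
    (π.mem_fixedPoints _ v).1 hv _ (transvectionGL_mem_glInt h01 hx₀O)
  have h := whittakerModel_transvectionGL_glCorner' π hn hΛ v a x₀ h01
  rw [hfix] at h
  have h' : (1 - (ψ ((a : F) * x₀) : ℂ)) *
      whittakerModel π Λ v (glCorner F hn.le (glDiagonal 1 F fun _ => a)) = 0 := by
    rw [sub_mul, one_mul, ← h, sub_self]
  rcases mul_eq_zero.1 h' with h1 | h1
  · exfalso
    apply hne
    rw [mul_comm]
    exact Circle.coe_eq_one.1 (sub_eq_zero.1 h1).symm
  · exact h1

/-- **`GL_n(𝒪)`-invariance on the corner torus**: `W_v(d(t u)) = W_v(d(t))` for `|u| = 1` and `v`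
fixed by `GL_n(𝒪)` (rank-`n` form of `whittakerModel_diagGL2_mul_of_valuation_eq_one`). [folklore] -/
theorem whittakerModel_glCorner_mul_of_valuation_eq_one [ValuativeRel F] (hn : 1 < n)
    (Λ : Module.Dual ℂ V) {v : V} (hv : v ∈ π.fixedPoints (glInt n F)) (t : Fˣ) {u : Fˣ}
    (hu : valuation F (u : F) = 1) :
    whittakerModel π Λ v (glCorner F hn.le (glDiagonal 1 F fun _ => t * u)) =
      whittakerModel π Λ v (glCorner F hn.le (glDiagonal 1 F fun _ => t)) := by
  have hmul : (fun _ : Fin 1 => t * u) = (fun _ => t) * (fun _ => u) := rfl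
  rw [hmul, map_mul, map_mul, whittakerModel_apply_apply_mul,
    (π.mem_fixedPoints _ v).1 hv _ (glCorner_glDiagonal_fin_one_mem_glInt' hn.le hu)]

/-- **Moving the functional along the diagonal torus does not change the corner values**: for a linear
form `Λ`, `v ∈ V` and `D = diagonalGL (Fin n) F d`, `W^{Λ}_{π(D) v}(d(h)) = W^{Λ ∘ π(D)}_v(d(h))`
(`d(h) D = D d(h)`).  Rank-`n` form of `whittakerModel_apply_diagGL2_diagGL2_eq_comp`. [folklore] -/
theorem whittakerModel_apply_diagonalGL_glCorner_eq_comp (hn : 1 < n) (Λ : Module.Dual ℂ V) (v : V)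
    (d : Fin n → Fˣ) (h : Fˣ) :
    whittakerModel π Λ (π (diagonalGL (Fin n) F d) v) (glCorner F hn.le (glDiagonal 1 F fun _ => h)) =
      whittakerModel π (Λ ∘ₗ π (diagonalGL (Fin n) F d)) v
        (glCorner F hn.le (glDiagonal 1 F fun _ => h)) := by
  rw [whittakerModel_apply, whittakerModel_apply, LinearMap.comp_apply, ← Module.End.mul_apply,
    ← map_mul, ← Module.End.mul_apply, ← map_mul,
    glCorner_glDiagonal_fin_one_mul_diagonalGL_comm' hn.le h d]

/-- **`Λ ∘ π(g) ≠ 0` for `Λ ≠ 0`**: `π(g)` is invertible with inverse `π(g⁻¹)` (rank-`n` form of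
`comp_ne_zero_of_ne_zero`). [folklore] -/
theorem dual_comp_rep_ne_zero' {Λ : Module.Dual ℂ V} (hΛ : Λ ≠ 0) (g : GL (Fin n) F) :
    Λ ∘ₗ (π g : V →ₗ[ℂ] V) ≠ 0 := by
  intro h
  apply hΛ
  ext v
  have := LinearMap.congr_fun h (π g⁻¹ v)
  rw [LinearMap.comp_apply, ← Module.End.mul_apply, ← map_mul, mul_inv_cancel, map_one,
    Module.End.one_apply] at this
  rw [this, LinearMap.zero_apply, LinearMap.zero_apply]

end Corner

/-! ### Part 2: the `(n, 1)` zeta integral against a constant `W'` is the corner-torus integral -/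

section Zeta

variable {F : Type*} [Field F] [ValuativeRel F] [TopologicalSpace F] [IsNonarchimedeanLocalField F]
  {n : ℕ}

/-- **The `GL_n × GL₁` Rankin–Selberg integrand at a `1 × 1` diagonal matrix** (`1 < n`):
`rsIntegrand W W' s (diag a) = W(diag(a⁻¹, 1_{n-1})) W'(diag a⁻¹) |a⁻¹|^{s - (n-1)/2}`
(rank-`n` form of `rsIntegrand_glDiagonal_fin_one`). [folklore] -/
theorem rsIntegrand_glDiagonal_fin_one_gl (hn : 1 < n) (W : GL (Fin n) F → ℂ) (W' : GL (Fin 1) F → ℂ)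
    (s : ℂ) (a : Fˣ) :
    rsIntegrand hn W W' s (glDiagonal 1 F fun _ => a) =
      W (glCorner F hn.le (glDiagonal 1 F fun _ => a⁻¹)) * W' (glDiagonal 1 F fun _ => a⁻¹) *
        (((normAbs F ((a⁻¹ : Fˣ) : F) : ℝ≥0) : ℝ) : ℂ) ^ (s - ((n : ℂ) - 1) / 2) := by
  have hinv : (glDiagonal 1 F fun _ => a)⁻¹ = glDiagonal 1 F fun _ => a⁻¹ := by
    rw [← map_inv]; rfl
  rw [rsIntegrand, hinv, det_glDiagonal_fin_one, Nat.cast_one]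

variable [MeasurableSpace F] [BorelSpace F]

/-- **The `(n, 1)` Rankin–Selberg zeta integral against a constant `W'` is the corner-torus integral.**
For the measure `ν` on `GL₁(F) ⧸ U₁` transported from a Haar measure `μ'` of `Fˣ` (`hint`, as produced by
`exists_haar_measure_quotient_fin_one` / `exists_isHaarMeasure_integral_eq`) and `W'` constant `= κ`:
`Ψ(s; W, W') = ∫_{Fˣ} W(diag(a, 1_{n-1})) κ |a|^{s - (n-1)/2} dμ'(a)` (rank-`n` form of
`rsZeta_eq_integral_torus` of `WhittakerTorusJacquetGL2`). [cite: JacquetPiatetskiShapiroShalika1983, §2.4]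
[cite: CogdellAnalyticTheory2004, §6.1] -/
theorem rsZeta_fin_one_eq_integral_corner (hn : 1 < n)
    [MeasurableSpace (GL (Fin 1) F ⧸ upperUnitriangular (Fin 1) F)]
    (μ' : Measure Fˣ) [μ'.IsHaarMeasure] (ν : Measure (GL (Fin 1) F ⧸ upperUnitriangular (Fin 1) F))
    (hint : ∀ f : GL (Fin 1) F ⧸ upperUnitriangular (Fin 1) F → ℂ,
      ∫ x, f x ∂ν = ∫ a : Fˣ, f (QuotientGroup.mk (glDiagonal 1 F fun _ => a)) ∂μ')
    (W : GL (Fin n) F → ℂ) {W' : GL (Fin 1) F → ℂ} {κ : ℂ} (hW' : ∀ g, W' g = κ) (s : ℂ) :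
    rsZeta hn ν W W' s =
      ∫ a : Fˣ, W (glCorner F hn.le (glDiagonal 1 F fun _ => a)) * κ *
        (((normAbs F (a : F) : ℝ≥0) : ℝ) : ℂ) ^ (s - ((n : ℂ) - 1) / 2) ∂μ' := by
  haveI : T2Space F := (isLocalField F).toT2Space
  haveI : BorelSpace Fˣ := Units.borelSpace
  haveI := isInvInvariant_of_isHaarMeasure_units μ'
  have hker : ∀ a : Fˣ, rsKernel hn W W' s (QuotientGroup.mk (glDiagonal 1 F fun _ => a)) =
      W (glCorner F hn.le (glDiagonal 1 F fun _ => a⁻¹)) * κ *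
        (((normAbs F ((a⁻¹ : Fˣ) : F) : ℝ≥0) : ℝ) : ℂ) ^ (s - ((n : ℂ) - 1) / 2) := by
    intro a
    rw [rsKernel_mk_of_fin_one, rsIntegrand_glDiagonal_fin_one_gl, hW']
  rw [rsZeta, hint]
  simp_rw [hker]
  exact integral_inv_eq_self (fun a : Fˣ => W (glCorner F hn.le (glDiagonal 1 F fun _ => a)) * κ *
    (((normAbs F (a : F) : ℝ≥0) : ℝ) : ℂ) ^ (s - ((n : ℂ) - 1) / 2)) μ'

omit [MeasurableSpace F] [BorelSpace F] in
/-- `(q⁻¹)^{s - (n-1)/2} = (√q)^{n-1} · q^{-s}` for `1 ≤ n` (the `δ^{1/2}`-shift of the `GL_n × GL₁`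
integrand; rank-`n` form of `inv_residueFieldCard_cpow_sub_one_half`). [folklore] -/
theorem inv_residueFieldCard_cpow_sub_pred_half' (hn : 1 ≤ n) (s : ℂ) :
    ((((residueFieldCard F : ℝ≥0)⁻¹ : ℝ≥0) : ℝ) : ℂ) ^ (s - ((n : ℂ) - 1) / 2) =
      ((Real.sqrt (residueFieldCard F) : ℝ) : ℂ) ^ (n - 1) * (residueFieldCard F : ℂ) ^ (-s) := by
  have hq0 : (0 : ℝ) ≤ (residueFieldCard F : ℝ) := Nat.cast_nonneg _
  have hr0 : (0 : ℝ) < (((residueFieldCard F : ℝ≥0)⁻¹ : ℝ≥0) : ℝ) := by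
    exact_mod_cast inv_residueFieldCard_pos (F := F)
  have hxq : ((((residueFieldCard F : ℝ≥0)⁻¹ : ℝ≥0) : ℝ) : ℂ) = ((residueFieldCard F : ℂ))⁻¹ := by
    rw [NNReal.coe_inv, NNReal.coe_natCast, Complex.ofReal_inv, Complex.ofReal_natCast]
  have hxne : ((((residueFieldCard F : ℝ≥0)⁻¹ : ℝ≥0) : ℝ) : ℂ) ≠ 0 := Complex.ofReal_ne_zero.2 hr0.ne'
  have harg : ((residueFieldCard F : ℕ) : ℂ).arg ≠ Real.pi := by
    rw [Complex.natCast_arg]; exact Real.pi_ne_zero.symm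
  have hcast : ((n : ℂ) - 1) / 2 = ((n - 1 : ℕ) : ℂ) * (1 / 2 : ℂ) := by
    rw [Nat.cast_sub hn, Nat.cast_one]; ring
  rw [show s - ((n : ℂ) - 1) / 2 = -(((n : ℂ) - 1) / 2) + s by ring, Complex.cpow_add _ _ hxne, hxq,
    Complex.inv_cpow _ _ harg, Complex.inv_cpow _ _ harg, Complex.cpow_neg, Complex.cpow_neg, inv_inv,
    hcast, Complex.cpow_nat_mul]
  congr 2
  rw [Real.sqrt_eq_rpow, Complex.ofReal_cpow hq0, Complex.ofReal_natCast]
  congr 1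
  push_cast
  ring

variable {V : Type*} [AddCommGroup V] [Module ℂ V] (π : Representation ℂ (GL (Fin n) F) V)
  [MeasurableSpace (GL (Fin 1) F ⧸ upperUnitriangular (Fin 1) F)]

/-- **The unramified computation for `GL_n × GL₁`** (spherical vector against the trivial character;
Jacquet–Shalika 1981, §2; Cogdell 2004, Thm. 3.3 — the case `(n, m) = (n, 1)`, where "unfolding to the
torus" is the shell decomposition `Fˣ = ⊔ₖ ϖᵏ𝒪ˣ`).  Let `ψ` have conductor `𝒪`, `Λ` be a
`ψ`-Whittaker functional, `v ∈ V^{GL_n(𝒪)}` a Hecke eigenvector with the eigenvalues of `α`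
(`T_r v = q^{r(n-r)/2} e_r(α) v`, `x` enumerating `α`), `ν` transported from a Haar measure `μ'` of
`Fˣ`, and `W' = Λ'(v')` the constant Whittaker function of the trivial representation of `GL₁(F)` on `ℂ`.
Then for `‖a q^{-s}‖ < 1` (`a ∈ α`):
`Ψ(s; W_v, W') = μ'(𝒪ˣ) Λ(v) Λ'(v') / ∏_{a ∈ α} (1 - a q^{-s})` — the corner torus integral, the shells
`integral_units_eq_tsum_shell`, and the corner torus sum `hasSum_whittakerModel_cornerTorus` at `m = 1`
(Shintani: `W_v(diag(ϖ^N, 1)) = q^{-N(n-1)/2} h_N(x) Λ(v)`).  Rank-`n` form of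
`rsZeta_spherical_glOneRep_eq` (`GL2RSLFactorUnramified`, there with a twist `χ`).
[cite: JacquetShalika1981, §2] [cite: CogdellAnalyticTheory2004, Thm. 3.3] [cite: Shintani1976, Theorem] -/
theorem rsZeta_spherical_trivial_eq_gl (hn : 1 < n) {ϖ : F} (hϖ : IsUniformizingElement ϖ)
    {ψ : AddChar F Circle} (hψ0 : ψ.HasConductorExp 0) {Λ : Module.Dual ℂ V}
    (hΛ : Λ ∈ whittakerFunctionals π ψ) {v : V} (hv : v ∈ π.fixedPoints (glInt n F))
    {α : Multiset ℂ} {x : Fin n → ℂ} (hx : (univ : Finset (Fin n)).val.map x = α)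
    (hT : ∀ r, 1 ≤ r → r ≤ n → heckeT π (Units.mk0 ϖ hϖ.ne_zero) r v =
      ((((Real.sqrt (residueFieldCard F)) ^ (r * (n - r)) : ℝ) : ℂ) * α.esymm r) • v)
    (μ' : Measure Fˣ) [μ'.IsHaarMeasure] (ν : Measure (GL (Fin 1) F ⧸ upperUnitriangular (Fin 1) F))
    (hint : ∀ f : GL (Fin 1) F ⧸ upperUnitriangular (Fin 1) F → ℂ,
      ∫ x, f x ∂ν = ∫ a : Fˣ, f (QuotientGroup.mk (glDiagonal 1 F fun _ => a)) ∂μ')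
    (Λ' : Module.Dual ℂ ℂ) (v' : ℂ) {s : ℂ} (hs : ∀ a ∈ α, ‖a * (residueFieldCard F : ℂ) ^ (-s)‖ < 1) :
    rsZeta hn ν (whittakerModel π Λ v) (whittakerModel (Representation.trivial ℂ (GL (Fin 1) F) ℂ) Λ' v') s =
      (μ' {x : Fˣ | valuation F (x : F) = 1}).toReal *
        (Λ v * Λ' v' * (((α.map fun a => (1 : ℂ[X]) - C a * X).prod).eval
          ((residueFieldCard F : ℂ) ^ (-s)))⁻¹) := by
  classical
  haveI : T2Space F := (isLocalField F).toT2Space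
  haveI : BorelSpace Fˣ := Units.borelSpace
  have hϖ0 : ϖ ≠ 0 := hϖ.ne_zero
  set ϖu : Fˣ := Units.mk0 ϖ hϖ0 with hϖu_def
  have hϖn : normAbs F (ϖu : F) = (residueFieldCard F : ℝ≥0)⁻¹ := by
    rw [hϖu_def, Units.val_mk0]; exact normAbs_eq_inv_of_isUniformizingElement hϖ
  set q : ℕ := residueFieldCard F with hq_def
  set t : ℂ := (q : ℂ) ^ (-s) with ht_def
  set sq : ℂ := ((Real.sqrt (residueFieldCard F) : ℝ) : ℂ) with hsq_def
  -- the trivial representation of `GL₁(F)` on `ℂ`: every vector is spherical with Satake parameter `{1}`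
  set ρ' : Representation ℂ (GL (Fin 1) F) ℂ := Representation.trivial ℂ (GL (Fin 1) F) ℂ with hρ'_def
  have hW' : ∀ g, whittakerModel ρ' Λ' v' g = Λ' v' := fun g => whittakerModel_trivial_apply Λ' v' g
  have hΛ' : Λ' ∈ whittakerFunctionals ρ' ψ := by
    rw [whittakerFunctionals_eq_top_of_fin_one]; exact Submodule.mem_top
  have hv'fix : v' ∈ ρ'.fixedPoints (glInt 1 F) := by
    rw [Representation.mem_fixedPoints]
    intro k _
    rw [hρ'_def, Representation.trivial_apply]
  have hy : (univ : Finset (Fin 1)).val.map (fun _ : Fin 1 => (1 : ℂ)) = ({1} : Multiset ℂ) := rfl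
  have hT' : ∀ r, 1 ≤ r → r ≤ 1 → heckeT ρ' (Units.mk0 ϖ hϖ.ne_zero) r v' =
      ((((Real.sqrt (residueFieldCard F)) ^ (r * (1 - r)) : ℝ) : ℂ) * ({1} : Multiset ℂ).esymm r) • v' := by
    intro r hr1 hr2
    obtain rfl : r = 1 := le_antisymm hr2 hr1
    rw [heckeT_self_apply _ _ hv'fix, hρ'_def, Representation.trivial_apply, Nat.sub_self, mul_zero,
      pow_zero, Complex.ofReal_one, one_mul, Multiset.esymm, Multiset.powersetCard_one,
      Multiset.map_singleton, Multiset.map_singleton, Multiset.prod_singleton, Multiset.sum_singleton,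
      one_smul]
  have hs' : ∀ a ∈ α, ∀ b ∈ ({1} : Multiset ℂ), ‖a * b * t‖ < 1 := by
    intro a ha b hb
    rw [Multiset.mem_singleton.1 hb, mul_one]
    exact hs a ha
  -- the zeta integral is the corner-torus integral
  rw [rsZeta_fin_one_eq_integral_corner hn μ' ν hint (whittakerModel π Λ v) hW' s]
  -- the corner torus sum (Shintani + Cauchy) at `m = 1`
  have hS := hasSum_whittakerModel_cornerTorus hn.le π ρ' hϖ hψ0 hψ0 hΛ hΛ' hv hv'fix hx hy hT hT' hs'
  have hpi : ∀ N : ℕ, piPowGL hϖ.ne_zero (fun _ : Fin 1 => N) = glDiagonal 1 F (fun _ => ϖu ^ N) :=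
    fun N => by rw [← glDiagonal_det_eq (piPowGL hϖ.ne_zero _), det_piPowGL_fin_one]
  set w : ℕ → ℂ := fun m =>
    whittakerModel π Λ v (glCorner F hn.le (glDiagonal 1 F fun _ => ϖu ^ m)) * Λ' v' *
      (sq ^ (n - 1) * t) ^ m with hw_def
  have hS' : HasSum w (Λ v * Λ' v' * ((satakePairPolynomial α {1}).eval t)⁻¹) := by
    convert hS using 1
    funext N
    simp only [hw_def, piAntidiag_univ_fin_one, Finset.sum_singleton, torusExponent_fin_one, zpow_zero,
      one_mul, hW', hpi, ← hsq_def, mul_pow, ← pow_mul]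
    ring
  have hsum : Summable fun m => ‖w m‖ := summable_norm_iff.2 hS'.summable
  -- the shell description of the integrand
  have hr0 : (0 : ℝ) < (((residueFieldCard F : ℝ≥0)⁻¹ : ℝ≥0) : ℝ) := by
    exact_mod_cast inv_residueFieldCard_pos (F := F)
  set f : Fˣ → ℂ := fun a => whittakerModel π Λ v (glCorner F hn.le (glDiagonal 1 F fun _ => a)) *
    Λ' v' * (((normAbs F (a : F) : ℝ≥0) : ℝ) : ℂ) ^ (s - ((n : ℂ) - 1) / 2) with hf_def
  have hf0 : ∀ a : Fˣ, 1 < normAbs F (a : F) → f a = 0 := fun a ha => by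
    simp only [hf_def]
    rw [whittakerModel_glCorner_eq_zero_of_one_lt π hn hψ0 hΛ hv ha, zero_mul, zero_mul]
  have hfv : ∀ (m : ℕ) (a : Fˣ), normAbs F (a : F) = ((residueFieldCard F : ℝ≥0)⁻¹) ^ (m : ℤ) →
      f a = w m := by
    intro m a ha
    set u : Fˣ := (ϖu ^ m)⁻¹ * a with hu_def
    have hau : a = ϖu ^ m * u := by rw [hu_def, mul_inv_cancel_left]
    have hu : valuation F (u : F) = 1 := by
      rw [← normAbs_eq_one_iff_valuation_eq_one, hu_def, Units.val_mul, Units.val_inv_eq_inv_val,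
        Units.val_pow_eq_pow_val, map_mul, map_inv₀, map_pow, hϖn, ha, zpow_natCast, inv_mul_cancel₀]
      exact pow_ne_zero _ inv_residueFieldCard_pos.ne'
    have hWa : whittakerModel π Λ v (glCorner F hn.le (glDiagonal 1 F fun _ => a)) =
        whittakerModel π Λ v (glCorner F hn.le (glDiagonal 1 F fun _ => ϖu ^ m)) := by
      rw [hau, whittakerModel_glCorner_mul_of_valuation_eq_one π hn Λ hv _ hu]
    have habs : (((normAbs F (a : F) : ℝ≥0) : ℝ) : ℂ) ^ (s - ((n : ℂ) - 1) / 2) = (sq ^ (n - 1) * t) ^ m := by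
      rw [ha, NNReal.coe_zpow, ofReal_zpow_cpow hr0, inv_residueFieldCard_cpow_sub_pred_half' hn.le,
        zpow_natCast]
    simp only [hf_def, hw_def]
    rw [hWa, habs]
  -- shells
  rw [integral_units_eq_tsum_shell μ' hf0 hfv hsum, hS'.tsum_eq, satakePairPolynomial_singleton_one]

end Zeta

/-! ### Part 3: the unramified `L`-factor divides `P` -/

section Main

variable {F : Type*} [Field F] [ValuativeRel F] [TopologicalSpace F] [IsNonarchimedeanLocalField F]
  {n : ℕ} {V : Type*} [AddCommGroup V] [Module ℂ V] (π : Representation ℂ (GL (Fin n) F) V)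
  [MeasurableSpace (GL (Fin 1) F ⧸ upperUnitriangular (Fin 1) F)]
  [BorelSpace (GL (Fin 1) F ⧸ upperUnitriangular (Fin 1) F)]

/-- **The unramified `L`-factor divides every JPSS `L`-polynomial of `(π, 1)` on `GL_n`** (`2 ≤ n`), for
EVERY `GL₁(F)`-invariant Radon full-support measure `ν` on `GL₁(F) ⧸ U₁`.  Let `π` be an irreducible
smooth `ψ`-generic representation of `GL_n(F)` (`ψ` continuous non-trivial, any conductor) and `α` a
Satake parameter of `π` (`IsSatakeParameter π ϖ α`, `ϖ` uniformising).  Then every `P` with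
`HasRSLFactor hn π 𝟙_{GL₁} ψ ν P` is divisible by `∏_{a ∈ α} (1 - a X)`: with `aψ` of conductor `𝒪`,
`Λ_a = Λ ∘ π(diag(1, a⁻¹, …, a^{1-n}))` (an `aψ`-Whittaker functional) and a spherical Hecke eigenvector
`v` with `Λ_a(v) ≠ 0` (Casselman–Shalika), the `(n,1)` zeta integral of `W_{Λ, π(d) v} ∈ 𝒲(π, ψ)`
against the constant Whittaker function of `𝟙` equals that of `W_{Λ_a, v}` and is EXACTLY
`μ'(𝒪ˣ) Λ_a(v) / ∏ (1 - a q^{-s})` for `re s ≫ 0` (`rsZeta_spherical_trivial_eq_gl`), while clause (a)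
makes it `R(q^{-s}) / P(q^{-s})` with `R` Laurent (`dvd_of_eval_mul_eq_const`).  Rank-`n` form of
`prod_one_sub_C_mul_X_dvd_of_hasRSLFactor` (`GL2UnramifiedLFactorDivisibility`).
[cite: JacquetShalika1981, §2] [cite: JacquetPiatetskiShapiroShalika1983, Thm. 2.7 (ii)]
[cite: CogdellAnalyticTheory2004, Thm. 3.3] -/
theorem prod_one_sub_C_mul_X_dvd_of_hasRSLFactor_gl (hn : 1 < n) [π.IsIrreducible]
    {ψ : AddChar F Circle} (hψ : ψ.IsContinuousNontrivial) (hgen : IsGeneric π ψ) {ϖ : Fˣ}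
    (hϖ : IsUniformizingElement (ϖ : F)) {α : Multiset ℂ} (hα : IsSatakeParameter π ϖ α)
    (ν : Measure (GL (Fin 1) F ⧸ upperUnitriangular (Fin 1) F))
    [SMulInvariantMeasure (GL (Fin 1) F) (GL (Fin 1) F ⧸ upperUnitriangular (Fin 1) F) ν]
    [IsFiniteMeasureOnCompacts ν] [ν.IsOpenPosMeasure] {P : ℂ[X]}
    (hP : HasRSLFactor hn π (Representation.trivial ℂ (GL (Fin 1) F) ℂ) ψ ν P) :
    (α.map fun a => (1 : ℂ[X]) - C a * X).prod ∣ P := by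
  classical
  letI : MeasurableSpace F := borel F
  haveI : BorelSpace F := ⟨rfl⟩
  haveI : T2Space F := (isLocalField F).toT2Space
  haveI : BorelSpace Fˣ := Units.borelSpace
  set q : ℕ := residueFieldCard F with hq_def
  have hq : 1 < q := one_lt_residueFieldCard F
  -- a dilate `aψ` of conductor `𝒪` and the shifted Whittaker functional `Λ_a = Λ ∘ π(d)`
  obtain ⟨a₀, ha₀, hψa⟩ := hψ.exists_mulShift_hasConductorExp_zero
  set a : Fˣ := Units.mk0 a₀ ha₀ with ha_def
  have hψa' : (ψ.mulShift (a : F)).HasConductorExp 0 := hψa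
  obtain ⟨Λ, hΛ, hΛ0⟩ := (isGeneric_iff π ψ).1 hgen
  set d : Fin n → Fˣ := fun i => a⁻¹ ^ (i : ℕ) with hd_def
  set D : GL (Fin n) F := diagonalGL (Fin n) F d with hD_def
  set Λa : Module.Dual ℂ V := Λ ∘ₗ (π D : V →ₗ[ℂ] V) with hΛa_def
  have hΛa : Λa ∈ whittakerFunctionals π (ψ.mulShift (a : F)) :=
    comp_diagonalGL_mem_whittakerFunctionals π ψ hΛ d a (fun i j hij => pow_inv_mul_inv_eq a hij)
  have hΛa0 : Λa ≠ 0 := dual_comp_rep_ne_zero' π hΛ0 D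
  -- the spherical Hecke eigenvector, `Λ_a(v) ≠ 0`
  obtain ⟨v, hv, -, hΛv, hTv⟩ :=
    exists_spherical_whittaker_ne_zero_of_isSatakeParameter π hϖ hψa' hα hΛa hΛa0
  obtain ⟨x, hx⟩ := exists_univ_val_map_eq (R := ℂ) hα.1
  have hmk : Units.mk0 ((ϖ : Fˣ) : F) hϖ.ne_zero = ϖ := Units.mk0_val _ _
  have hT : ∀ r, 1 ≤ r → r ≤ n → heckeT π (Units.mk0 ((ϖ : Fˣ) : F) hϖ.ne_zero) r v =
      ((((Real.sqrt (residueFieldCard F)) ^ (r * (n - r)) : ℝ) : ℂ) * α.esymm r) • v := by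
    intro r _ hr
    rw [hmk]
    exact hTv r hr
  -- the Haar measure `μ'` of `Fˣ` behind `ν`, and the constant `c = μ'(𝒪ˣ) Λ_a(v) ≠ 0`
  obtain ⟨μ', hμ', hint⟩ := exists_isHaarMeasure_integral_eq ν
  haveI := hμ'
  set c : ℂ := ((μ' {x : Fˣ | valuation F (x : F) = 1}).toReal : ℂ) * Λa v with hc_def
  have hc0 : c ≠ 0 := by
    refine mul_ne_zero ?_ hΛv
    exact_mod_cast (ENNReal.toReal_pos (measure_unitSphere_pos μ').ne'
      (measure_unitSphere_lt_top μ').ne).ne'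
  -- the test pair `(Λ, π(d) v)` for `ψ` and `(id, 1)` for the trivial representation: clause (a)
  have hid : (LinearMap.id : Module.Dual ℂ ℂ) ∈
      whittakerFunctionals (Representation.trivial ℂ (GL (Fin 1) F) ℂ) ψ⁻¹ := by
    rw [whittakerFunctionals_eq_top_of_fin_one]
    exact Submodule.mem_top
  obtain ⟨R, hR, hRe⟩ := hP.2.1 Λ hΛ LinearMap.id hid (π D v) 1
  have hW' : ∀ g, whittakerModel (Representation.trivial ℂ (GL (Fin 1) F) ℂ) LinearMap.id (1 : ℂ) g =
      (1 : ℂ) := fun g => by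
    rw [whittakerModel_trivial_apply]; rfl
  -- the zeta integral of `W_{Λ, π(d) v}` is that of `W_{Λ_a, v}` (both only sample the corner torus)
  have hZeq : ∀ s : ℂ, rsZeta hn ν (whittakerModel π Λ (π D v))
      (whittakerModel (Representation.trivial ℂ (GL (Fin 1) F) ℂ) LinearMap.id 1) s =
      rsZeta hn ν (whittakerModel π Λa v)
        (whittakerModel (Representation.trivial ℂ (GL (Fin 1) F) ℂ) LinearMap.id 1) s := by
    intro s
    rw [rsZeta_fin_one_eq_integral_corner hn μ' ν hint _ hW' s,
      rsZeta_fin_one_eq_integral_corner hn μ' ν hint _ hW' s]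
    refine integral_congr_ae (Eventually.of_forall fun h => ?_)
    simp only [hΛa_def, hD_def]
    rw [whittakerModel_apply_diagonalGL_glCorner_eq_comp π hn Λ v d h]
  -- `P_α(q^{-s}) Z(s) = c` for `re s` large, and the comparison
  obtain ⟨c₀, hc₀⟩ := exists_forall_norm_mul_mul_qpow_lt_one hq α ({1} : Multiset ℂ)
  refine dvd_of_eval_mul_eq_const hq hP.ne_zero ?_ _ hR hRe hc0 (σ₀ := c₀) fun s hs => ?_
  · rw [← satakePairPolynomial_singleton_one, eval_zero_satakePairPolynomial]
    exact one_ne_zero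
  · have hs1 := hc₀ s hs
    have hs' : ∀ b ∈ α, ‖b * (q : ℂ) ^ (-s)‖ < 1 := fun b hb => by
      simpa only [mul_one] using hs1 b hb 1 (Multiset.mem_singleton_self _)
    have hD : ((α.map fun a => (1 : ℂ[X]) - C a * X).prod).eval ((q : ℂ) ^ (-s)) ≠ 0 := by
      rw [← satakePairPolynomial_singleton_one]
      exact eval_satakePairPolynomial_ne_zero_of_norm_lt_one hs1
    rw [hZeq s, rsZeta_spherical_trivial_eq_gl π hn hϖ hψa' hΛa hv hx hT μ' ν hint LinearMap.id 1 hs',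
      LinearMap.id_apply, mul_one, hc_def, ← hq_def]
    field_simp

/-- **Equality for `deg P ≤ n`.**  Under the hypotheses of `prod_one_sub_C_mul_X_dvd_of_hasRSLFactor_gl`,
if moreover `deg P ≤ n` then `P = ∏_{a ∈ α} (1 - a X)`: the Satake parameters of an irreducible `π` are
non-zero (`IsSatakeParameter.forall_ne_zero_holds`), so `deg ∏ (1 - a X) = n`, and `P(0) = 1`.
(Jacquet–Shalika 1981, §2: `L(s, π) = ∏ (1 - αᵢ q^{-s})⁻¹` for unramified `π`.)
[cite: JacquetShalika1981, §2] -/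
theorem prod_one_sub_C_mul_X_eq_of_hasRSLFactor_of_natDegree_le_gl (hn : 1 < n) [π.IsIrreducible]
    {ψ : AddChar F Circle} (hψ : ψ.IsContinuousNontrivial) (hgen : IsGeneric π ψ) {ϖ : Fˣ}
    (hϖ : (valuation F).IsUniformizer (ϖ : F)) {α : Multiset ℂ} (hα : IsSatakeParameter π ϖ α)
    (ν : Measure (GL (Fin 1) F ⧸ upperUnitriangular (Fin 1) F))
    [SMulInvariantMeasure (GL (Fin 1) F) (GL (Fin 1) F ⧸ upperUnitriangular (Fin 1) F) ν]
    [IsFiniteMeasureOnCompacts ν] [ν.IsOpenPosMeasure] {P : ℂ[X]}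
    (hP : HasRSLFactor hn π (Representation.trivial ℂ (GL (Fin 1) F) ℂ) ψ ν P)
    (hdeg : P.natDegree ≤ n) :
    P = (α.map fun a => (1 : ℂ[X]) - C a * X).prod := by
  classical
  have hdvd := prod_one_sub_C_mul_X_dvd_of_hasRSLFactor_gl π hn hψ hgen
    (isUniformizingElement_of_isUniformizer hϖ) hα ν hP
  have hne : ∀ a ∈ α, a ≠ 0 := fun a ha => IsSatakeParameter.forall_ne_zero_holds hϖ hα a ha
  set D : ℂ[X] := (α.map fun a => (1 : ℂ[X]) - C a * X).prod with hD
  -- `deg D = card α = n`, `D(0) = 1`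
  have hDdeg : D.natDegree = n := by
    rw [hD, ← hα.1]
    -- adapted from `natDegree_prod_one_sub_C_mul_X_recGLn` (summit-side, c5 stub H4)
    clear hD hdvd hdeg hP hα D
    revert hne
    induction α using Multiset.induction_on with
    | empty => intro; simp
    | cons b s ih =>
      intro hne
      have hb : b ≠ 0 := hne b (Multiset.mem_cons_self b s)
      have hs := ih fun a ha => hne a (Multiset.mem_cons_of_mem ha)
      obtain ⟨h1, h1'⟩ := natDegree_one_sub_C_mul_X hb
      have hs' : (s.map fun a => (1 : ℂ[X]) - C a * X).prod ≠ 0 := fun h0 => by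
        simpa [eval_multiset_prod] using congrArg (eval 0) h0
      simp only [Multiset.map_cons, Multiset.prod_cons, Multiset.card_cons]
      rw [natDegree_mul h1' hs', h1, hs, add_comm]
  have hD0 : D.eval 0 = 1 := by
    rw [hD, ← satakePairPolynomial_singleton_one, eval_zero_satakePairPolynomial]
  have hPne : P ≠ 0 := hP.ne_zero
  obtain ⟨E, hE⟩ := hdvd
  have hEne : E ≠ 0 := by rintro rfl; exact hPne (by rw [hE, mul_zero])
  have hDne : D ≠ 0 := fun h => by
    rw [h, Polynomial.natDegree_zero] at hDdeg
    omega
  have hdegE : E.natDegree = 0 := by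
    have h := Polynomial.natDegree_mul hDne hEne
    rw [← hE, hDdeg] at h
    omega
  obtain ⟨e, rfl⟩ := Polynomial.natDegree_eq_zero.1 hdegE
  -- compare constant terms: `P(0) = 1 = D(0) e`
  have he : e = 1 := by
    have h := hP.1
    rw [hE, Polynomial.eval_mul, hD0, one_mul, Polynomial.eval_C] at h
    exact h
  rw [hE, he, map_one, mul_one]

end Main

end Literature.NumberTheory.Automorphic

end
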